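import Summits.AtomisticToContinuum.Crystallization.Theses.PhononSlackCertificates

/-!
# Route `PhononSlackCertificates`, crux `CoerciveTwoShellGap` (stmt-AtomisticToContinuum-13956),
# line `Sketch`: stub `stub_torusSlice` — THE `1/20`-SLICE ON THE TORUS

Card A's torus coercivity in the FLOORED, CAPPED SQUARED MISFIT (floor `1/50`, cap `3/20`): some
`c > 0` makes every periodic configuration `P` of `ℝ³` with `1/3`-separated point set pay `c` times
the motif mean of `m_y := sSup ({0} ∪ {ε² − (1/50)² : 1/50 < ε ≤ 3/20, y is ε-bad in P.points})`
above the periodic Lennard-Jones infimum `e* = ⨅_Q e(Q)`.  This implies the torus two-shell gap at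
tolerance `1/20` with `g = c · ((1/20)² − (1/50)²) = 21c/10⁴`:
`e* + g · #{y ∈ motif : y is 1/20-bad in P.points} / #motif ≤ e(P)`.

PROOF.  For each point `y` the misfit set `S_y` is bounded above by `(3/20)²` and contains `0`, so
`0 ≤ sSup S_y` (`le_csSup`); at a `1/20`-bad motif point `(1/20)² − (1/50)² ∈ S_y` (take
`ε = 1/20`), so `(1/20)² − (1/50)² ≤ sSup S_y`.  Summing over the bad motif points and enlarging
to the whole motif gives `((1/20)² − (1/50)²) · #bad ≤ Σ_{y ∈ motif} sSup S_y`; divide by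
`#motif > 0`, multiply by `c`, and chain with the hypothesis.  A port to the torus of the finite
slice lemma `coerciveTwoShellGap_of_quadraticMisfitCoercivity` of the ideator sketch
(`Cruxes/CoerciveTwoShellGap/IdeatorOneSketch.lean`).  No definition, no named fact; all
`[folklore]`.
-/

noncomputable section

namespace Summit.AtomisticToContinuum.Crystallization.Theorems.CoerciveTwoShellGapTorusSlice

open scoped BigOperators Classical
open Literature.MathematicalPhysics.StatisticalMechanics Literature.Geometry.DiscreteGeometry

-- adapted from Summits/.../Cruxes/CoerciveTwoShellGap/IdeatorOneSketch.lean
-- (misfitSq_bddAbove, misfitSq_nonneg, sq_sub_sq_le_misfitSq, coerciveTwoShellGap_of_quadraticMisfitCoercivity)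

/-- The floored capped squared misfit set `{0} ∪ {ε² − (1/50)² : 1/50 < ε ≤ 3/20, y is ε-bad in Y}`
of a point `y` of a set `Y ⊂ ℝ³` is bounded above, by `(3/20)²`. [folklore] -/
theorem misfitSet_bddAbove (Y : Set (EuclideanSpace ℝ (Fin 3))) (y : EuclideanSpace ℝ (Fin 3)) :
    BddAbove ({0} ∪ {t : ℝ | ∃ ε : ℝ, 1 / 50 < ε ∧ ε ≤ 3 / 20 ∧ t = ε ^ 2 - (1 / 50) ^ 2 ∧
      ¬ IsTwoShellGoodSet ε (47 / 50) 1 Y y}) := by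
  refine ⟨(3 / 20 : ℝ) ^ 2, ?_⟩
  rintro t (ht | ⟨ε, hε0, hεθ, rfl, -⟩)
  · rw [Set.mem_singleton_iff] at ht
    rw [ht]
    positivity
  · have h1 : ε ^ 2 ≤ (3 / 20 : ℝ) ^ 2 := pow_le_pow_left₀ (by linarith) hεθ 2
    have h2 : (0 : ℝ) ≤ (1 / 50 : ℝ) ^ 2 := by positivity
    linarith

/-- The supremum of the floored capped squared misfit set of any point is non-negative (the set
contains `0` and is bounded above). [folklore] -/
theorem misfitSet_sSup_nonneg (Y : Set (EuclideanSpace ℝ (Fin 3))) (y : EuclideanSpace ℝ (Fin 3)) :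
    0 ≤ sSup ({0} ∪ {t : ℝ | ∃ ε : ℝ, 1 / 50 < ε ∧ ε ≤ 3 / 20 ∧ t = ε ^ 2 - (1 / 50) ^ 2 ∧
      ¬ IsTwoShellGoodSet ε (47 / 50) 1 Y y}) :=
  le_csSup (misfitSet_bddAbove Y y) (Set.mem_union_left _ (Set.mem_singleton 0))

/-- At a `1/20`-bad point the supremum of the floored capped squared misfit set is at least
`(1/20)² − (1/50)²`: take `ε = 1/20 ∈ (1/50, 3/20]`. [folklore] -/
theorem sq_sub_sq_le_misfitSet_sSup {Y : Set (EuclideanSpace ℝ (Fin 3))}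
    {y : EuclideanSpace ℝ (Fin 3)} (hbad : ¬ IsTwoShellGoodSet (1 / 20) (47 / 50) 1 Y y) :
    (1 / 20 : ℝ) ^ 2 - (1 / 50) ^ 2 ≤
      sSup ({0} ∪ {t : ℝ | ∃ ε : ℝ, 1 / 50 < ε ∧ ε ≤ 3 / 20 ∧ t = ε ^ 2 - (1 / 50) ^ 2 ∧
        ¬ IsTwoShellGoodSet ε (47 / 50) 1 Y y}) :=
  le_csSup (misfitSet_bddAbove Y y)
    (Set.mem_union_right _ ⟨1 / 20, by norm_num, by norm_num, rfl, hbad⟩)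

/-- **Counting against the misfit sum.**  For every periodic configuration `P` of `ℝ³`,
`((1/20)² − (1/50)²) · #{y ∈ motif : y is 1/20-bad in P.points} ≤ Σ_{y ∈ motif} sSup S_y`:
each bad motif point contributes at least `(1/20)² − (1/50)²` (`sq_sub_sq_le_misfitSet_sSup`) and
every other motif point at least `0` (`misfitSet_sSup_nonneg`). [folklore] -/
theorem mul_card_bad_le_sum_misfit (P : PeriodicConfiguration 3) :
    ((1 / 20 : ℝ) ^ 2 - (1 / 50) ^ 2) *
        ((P.motif.filter fun y => ¬ IsTwoShellGoodSet (1 / 20) (47 / 50) 1 P.points y).card : ℝ) ≤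
      ∑ y ∈ P.motif,
        sSup ({0} ∪ {t : ℝ | ∃ ε : ℝ, 1 / 50 < ε ∧ ε ≤ 3 / 20 ∧ t = ε ^ 2 - (1 / 50) ^ 2 ∧
          ¬ IsTwoShellGoodSet ε (47 / 50) 1 P.points y}) := by
  calc ((1 / 20 : ℝ) ^ 2 - (1 / 50) ^ 2) *
        ((P.motif.filter fun y => ¬ IsTwoShellGoodSet (1 / 20) (47 / 50) 1 P.points y).card : ℝ)
      = ∑ y ∈ (P.motif.filter fun y => ¬ IsTwoShellGoodSet (1 / 20) (47 / 50) 1 P.points y),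
          ((1 / 20 : ℝ) ^ 2 - (1 / 50) ^ 2) := by
        rw [Finset.sum_const, nsmul_eq_mul, mul_comm]
    _ ≤ ∑ y ∈ (P.motif.filter fun y => ¬ IsTwoShellGoodSet (1 / 20) (47 / 50) 1 P.points y),
          sSup ({0} ∪ {t : ℝ | ∃ ε : ℝ, 1 / 50 < ε ∧ ε ≤ 3 / 20 ∧ t = ε ^ 2 - (1 / 50) ^ 2 ∧
            ¬ IsTwoShellGoodSet ε (47 / 50) 1 P.points y}) :=
        Finset.sum_le_sum fun y hy => sq_sub_sq_le_misfitSet_sSup (Finset.mem_filter.1 hy).2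
    _ ≤ ∑ y ∈ P.motif,
          sSup ({0} ∪ {t : ℝ | ∃ ε : ℝ, 1 / 50 < ε ∧ ε ≤ 3 / 20 ∧ t = ε ^ 2 - (1 / 50) ^ 2 ∧
            ¬ IsTwoShellGoodSet ε (47 / 50) 1 P.points y}) :=
        Finset.sum_le_sum_of_subset_of_nonneg (Finset.filter_subset _ _)
          fun y _ _ => misfitSet_sSup_nonneg P.points y

/-- **Stub `stub_torusSlice` — the `1/20`-slice on the torus** of line `Sketch` (crux
`PhononSlackCertificates.CoerciveTwoShellGap`, item 13956).  Card A's torus coercivity in the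
FLOORED, CAPPED SQUARED MISFIT (floor `1/50`, cap `3/20`: every periodic configuration of `ℝ³` with
`1/3`-separated point set pays `c` times the motif mean of
`sSup ({0} ∪ {ε² − (1/50)² : 1/50 < ε ≤ 3/20, y is ε-bad in P.points})` above `e* = ⨅_Q e(Q)`)
implies the torus two-shell gap at tolerance `1/20` with `g = c · ((1/20)² − (1/50)²) = 21c/10⁴`:
at a `1/20`-bad motif point the supremum is `≥ (1/20)² − (1/50)²` (`le_csSup`, the set is bounded
by `(3/20)²`), and it is `≥ 0` everywhere (`mul_card_bad_le_sum_misfit`); divide by `#motif > 0`.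
[folklore] -/
theorem stub_torusSlice :
    (∃ c : ℝ, 0 < c ∧ ∀ P : PeriodicConfiguration 3,
        (∀ u ∈ P.points, ∀ v ∈ P.points, u ≠ v → (1 / 3 : ℝ) ≤ dist u v) →
        (⨅ Q : PeriodicConfiguration 3, Q.energyPerParticle lennardJones)
          + c * ((P.motif.card : ℝ)⁻¹ * ∑ y ∈ P.motif,
              sSup ({0} ∪ {t : ℝ | ∃ ε : ℝ, 1 / 50 < ε ∧ ε ≤ 3 / 20 ∧ t = ε ^ 2 - (1 / 50) ^ 2 ∧
                ¬ IsTwoShellGoodSet ε (47 / 50) 1 P.points y}))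
          ≤ P.energyPerParticle lennardJones) →
    ∃ g : ℝ, 0 < g ∧ ∀ P : PeriodicConfiguration 3,
        (∀ u ∈ P.points, ∀ v ∈ P.points, u ≠ v → (1 / 3 : ℝ) ≤ dist u v) →
        (⨅ Q : PeriodicConfiguration 3, Q.energyPerParticle lennardJones)
          + g * ((P.motif.filter fun y => ¬ IsTwoShellGoodSet (1 / 20) (47 / 50) 1 P.points y).card : ℝ)
              / (P.motif.card : ℝ)
          ≤ P.energyPerParticle lennardJones := by
  rintro ⟨c, hc, hP⟩
  have hgap : (0 : ℝ) < (1 / 20 : ℝ) ^ 2 - (1 / 50) ^ 2 := by norm_num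
  refine ⟨c * ((1 / 20 : ℝ) ^ 2 - (1 / 50) ^ 2), mul_pos hc hgap, fun P hsep => ?_⟩
  have key := hP P hsep
  have hm : (0 : ℝ) < (P.motif.card : ℝ) := Nat.cast_pos.2 (Finset.card_pos.2 P.motif_nonempty)
  have h2 := mul_le_mul_of_nonneg_left
    (mul_le_mul_of_nonneg_left (mul_card_bad_le_sum_misfit P) hc.le) (inv_nonneg.2 hm.le)
  rw [div_eq_mul_inv]
  linarith [h2, key]

end Summit.AtomisticToContinuum.Crystallization.Theorems.CoerciveTwoShellGapTorusSlice

end
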